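import Summits.Schanuel.Schanuel.Theorems.RootDecomp1KRelLiouvilleCell02
import Summits.Schanuel.Schanuel.Theorems.RootDecomp1KDarkLogSq04
import Summits.Schanuel.Schanuel.Theorems.RootDecomp1KDarkLogSq05
import Summits.Schanuel.Schanuel.Theorems.RootDecomp1KRelLiouvilleCell05
import Summits.Schanuel.Schanuel.Theorems.RootDecomp1KGeneric16
import Summits.Schanuel.Schanuel.Theorems.RootDecomp1KHyper59
import Summits.Schanuel.Schanuel.Theorems.RootDecomp1KPiCells
import Literature.Barriers.Schanuel.NesterenkoModularScopeMeasureHoldsProofs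
import Literature.Barriers.Schanuel.NesterenkoModularScopeMeasurePolys
import Literature.Barriers.Schanuel.NesterenkoModularScopeValuesProofs
import Literature.NumberTheory.Transcendental.NesterenkoEliminationFacts2Proofs
import Literature.NumberTheory.Transcendental.PhilipponCriterionPrincipal
import Literature.NumberTheory.Transcendental.PhilipponCriterionHomogenization
import Mathlib.Algebra.MvPolynomial.Funext
import Mathlib.Algebra.MvPolynomial.Division

/-!
# RootDecomp1KPiScale — lens 6, generation 20 «NESTERENKO-MEASURED SCALE π» (frame G20: lane T = the hypothesis-free DISCHARGE of the strong measure (31) at ω̄(e^{−2π}) from the tree-proved Nesterenko Ch. 3 Thm 5.1 / Prop 4.11 / Prop 4.8 ⇒ `LogPowMeasure ![π, e^π]`; lane F = K-R27 (F₊) cells on the π-lines for every log-hyper-Liouville ratio) — part 1 (RootDecomp1KPiScale01): §1–§4 the Ramanujan point, 𝔭 = (x₄), homogenisation, THE MEASURE (31) `measure31_theta3` (lane T discharge)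

PORT NOTE (census-1 gen 17, 2026-08-31): port of [HOME/decomp-schanuel-lens-6/g20/PiScale.lean sha256 87044252…, 707 l, imports TREE only (RelLiouvilleCell02/05, DarkLogSq04/05, Generic16, Hyper59, PiCells, Literature Nesterenko*/Philippon* proof modules, Mathlib MvPolynomial.Funext/Division) + PiScaleProbe + PiScaleCtrl + NODE-g20.md; CLAIM L1953, crit g8 RULING L1963 (FRAME G20), NODE L1983 / REQUEST L1984, critic VERDICT L1986 (crit g8: CLEARED — LANE T: ONE THEOREM credit (the hypothesis-free discharge `measure31_theta3` / `LogPowMeasure ![π, e^π]`); LANE F: ONE K-R27 (F₊) CELL credit (the π-line cells); lens-6 tally THEOREM ×3 + CELL ×3; PORT GO)]; own farm rc 0 · 0 warn · 0 sorry · axioms std; NO def : Prop fact binder anywhere (inputs = tree THEOREMS `thm_5_1_holds`, `prop_4_11_holds`, `prop_4_8_holds`, `exists_homogenization`, `ramanujan_values_exp_neg_two_pi_holds`).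
Split in three parts for the 400-line cap: 01 = §1 the Ramanujan point q_π = e^{−2π} (`qπ`, `θ3`, `θ2`) + §2 the prime ideal 𝔭 = (x₄) (prime, homogeneous, unmixed of rank 4, ‖x₄‖_ω̄ = |R(q_π)| = 0) + §3 homogenisation (`lift4`, E ∉ (x₄)) + §4 THE MEASURE (31) `measure31_theta3` (lane T; `maxHeartbeats 800000 in` carried); 02 = §5 the tree class `LogPowMeasure` (k = 28) for θ₃ / θ₂ and `![π, e^π]`, hypothesis-free; 03 = §6 the CELLS (Schanuel's bound on Schanuel fields containing π, e^π and a log-hyper-Liouville real; the π-line cells; §6a the member of the newly decided gap; §6b the tree's π-cells with their h52 binder REMOVED) + §7 the certificate (the n = 3 residual of record shrinks on the scale family (ℤ∖0)⁻¹π).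
PORT EDITS: the three `set_option linter.*` lines dropped; 24 one-line docstrings; `logHyperLiouville_of_hyperLiouville` private; the unused item-text binders of `item33364_three_piLineClass` / `item33363_three_piLineClass` `_`-prefixed (`hz hL hH` → `_hz _hL _hH`, linter — binder TYPES verbatim, positional application unchanged); statements and proofs otherwise verbatim; the LIVE `Iff.rfl`/positional probes and the 26 guards stay in the HOME probe. `--supports stmt-Schanuel-33364`; no census credit carried; nothing here proves Schanuel or the items; rung 0. The lens's header follows.
-/

/-!
# RootDecomp1KPiScale — lens 6, generation 20 «NESTERENKO-MEASURED SCALE π»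

HOME kernel of `decomp-schanuel-lens-6` gen 20 (PATH T: HOME-only, sorry-free, against the LIVE route
`route-Schanuel-RootDecomp1K`; nothing here is a ledger write; rung 0; no item of the route closes).

## What is proved (hypothesis-free: no registered fact is taken as a hypothesis)

§1–§4  **The log-height form (31) of LNM 1752 Ch. 3 Cor. 5.2 at `q₀ = e^{-2π}`**, DERIVED from the tree-proved
Theorem 5.1 (`Literature.Barriers.Schanuel.NesterenkoPhilippon2001_ch3_thm_5_1_holds`, `r = 3`) and the tree-proved
elimination toolkit (Prop. 4.8 `…prop_4_8_holds`, Prop. 4.11 `…prop_4_11_holds`, `exists_homogenization`):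

  `∃ c > 0, ∀ B ∈ ℤ[y₁,y₂,y₃] ∖ 0, ∀ T ≥ max (deg B + log H(B)) e :  exp(−c·T⁴·(log T)²⁴) ≤ |B(q₀, P(q₀), Q(q₀))|`

(`P(q₀) = 3/π`, `Q(q₀) = 3Γ(1/4)⁸/(2π)⁶`, `R(q₀) = 0` — tree `ramanujan_values_exp_neg_two_pi_holds`).  The route of
p. 47 of LNM 1752: `𝔭 := (x₄)` (prime, homogeneous, unmixed of rank 4, `|𝔭(ω̄)| = 0` since `ω̄₄ = R(q₀) = 0`),
`E :=` the homogenisation of `B`, `E ∉ (x₄)`, `J :=` the metric Bézout cut of `𝔭` by `E` (Prop. 4.11, rank 3),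
Theorem 5.1 at `J`.  The REGISTERED `…NesterenkoPhilippon2001_ch3_cor_5_2` is the literal print form
(`T ≥ H(A) + deg A`, a WEAK measure); (31) is the log-height form, i.e. a `LogPowMeasure` (tree class, k = 28).

§5  `LogPowMeasure θ₃`, `θ₃ = (q₀, P(q₀), Q(q₀))`, and `LogPowMeasure θ₂`, `θ₂ = (q₀, P(q₀))` — hypothesis-free.

§6  CELLS via the TREE principle `RootDecomp1KRelLiouvilleCell.sb_of_logHyperLiouville_of_logPowMeasure`:
`SB 3 z` for every `z : Fin 3 → ℂ` whose Schanuel field `ℚ(z, e^z, i)` contains `π`, `e^π` and a real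
log-hyper-Liouville `ρ`; in particular the LINE CELLS `(π/k, ρ·π/k, w)`, every `w ∈ ℂ`, every `k ∈ ℤ ∖ 0`, every
`ρ ∈ LogHyperLiouville` (tree: `hyperCell_pi_any` needs `HyperLiouville ρ` AND the registered Cor. 5.2; `ordCell_any`
needs `LiouvilleOrder 49 ρ` AND NW96 Thm 1); the shapes `(π/k, ρ, w)` and `(π/k, w, ρ·w)`; `SB 4 (π/k, ρ·π/k, Γ(1/4), w)`;
the cell predicate `PiScaleClass` with `sb_three_of_piScaleClass`; §6a the MEMBER `ℓ_T ∈ LogHyperLiouville ∖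
(HyperLiouville ∪ LiouvilleOrder 49)` (tree facts) with its decided instances; §6b the tree theorems `hyperCell_pi_any`,
`hyperCell_pi_gamma_any` with their `h52` binder REMOVED.

§7  CERTIFICATE (g19 shape): on the scale family `u ∈ (ℤ ∖ 0)⁻¹·π` the `n = 3` residual of record of item 33364
(`RootDecomp1KGeneric.sb_three_lineCell_of_lowOrderResidual`: «Liouville ρ, NO exponential order 49») shrinks to
«Liouville ρ ∧ ¬ LogHyperLiouville ρ»; item texts 33364 / 33363 read back at `n = 3` on that class.

HONEST SCOPE: other scales `u` are not touched; the measure is proved at `θ₂ = (e^{-2π}, 3/π)` / `θ₃` — the tuples the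
cells consume — and NOT transported to the literal tuple `(π, e^{π}, Γ(1/4))` (that is the norm step of p. 47, through
the algebraic extension `ℚ(π, e^{π}, Γ(1/4)) ⊇ ℚ(θ₃)` of degree ≤ 16, not done here); accordingly neither the general
registered fact `…cor_5_2` (all `q`, all `ξ`, Thm 1.1 + norm) nor the conclusion of `…cor_5_2_pi_of` is discharged;
items stmt-Schanuel-33364 / 33363 / 31077 stay OPEN; rung 0.
-/

noncomputable section

open Complex IntermediateField
open MvPolynomial (aeval rename X C)
open Literature.NumberTheory.Transcendental
open Literature.NumberTheory.Transcendental.Nesterenko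
open Literature.Barriers.Schanuel
open Summit.Schanuel.Schanuel.Theorems.RootDecomp1KHyper
open Summit.Schanuel.Schanuel.Theorems.RootDecomp1KHyper.HyperCell
open Summit.Schanuel.Schanuel.Theorems.RootDecomp1KGeneric
open Summit.Schanuel.Schanuel.Theorems.RootDecomp1KRelLiouvilleCell
open Summit.Schanuel.Schanuel.Theorems.RootDecomp1KDarkLogSq
open Summit.Schanuel.Schanuel.Theorems.RootDecomp1KHyper.HyperCell.LatCell.Bilog (mvlen_rename)

attribute [local instance] MvPolynomial.gradedAlgebra

namespace Summit.Schanuel.Schanuel.Theorems.RootDecomp1KPiScale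

/-! ## §1  The Ramanujan point at `q₀ = e^{-2π}` -/

/-- `q₀ = e^{−2π}` as a complex number. -/
def qπ : ℂ := ((Real.exp (-(2 * Real.pi)) : ℝ) : ℂ)

/-- `‖q_π‖ = e^{−2π}`. -/
theorem norm_qπ : ‖qπ‖ = Real.exp (-(2 * Real.pi)) := by
  rw [qπ, Complex.norm_real, Real.norm_eq_abs, abs_of_pos (Real.exp_pos _)]

/-- `0 < ‖q_π‖`. -/
theorem norm_qπ_pos : 0 < ‖qπ‖ := by rw [norm_qπ]; exact Real.exp_pos _

/-- `‖q_π‖ < 1`. -/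
theorem norm_qπ_lt_one : ‖qπ‖ < 1 := by
  rw [norm_qπ, ← Real.exp_zero]
  exact Real.exp_lt_exp.mpr (by have := Real.pi_pos; linarith)

/-- `q_π ≠ 0`. -/
theorem qπ_ne_zero : qπ ≠ 0 := norm_pos_iff.mp norm_qπ_pos

/-- `q₀ = (e^π)^(-2)` (as an integer power). -/
theorem qπ_eq_zpow : qπ = cexp (Real.pi : ℂ) ^ (-2 : ℤ) := by
  rw [qπ, Complex.ofReal_exp, ← Complex.exp_int_mul]
  congr 1; push_cast; ring

/-- `P(q_π) = 3/π` (tree Ramanujan values at `e^{−2π}`). -/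
theorem ramanujanP_qπ : ramanujanP qπ = 3 / (Real.pi : ℂ) := ramanujan_values_exp_neg_two_pi_holds.1

/-- `Q(q_π) = 3Γ(1/4)⁸/(2π)⁶`. -/
theorem ramanujanQ_qπ :
    ramanujanQ qπ = 3 * (Real.Gamma (1 / 4) : ℂ) ^ 8 / (2 * (Real.pi : ℂ)) ^ 6 :=
  ramanujan_values_exp_neg_two_pi_holds.2.1

/-- `R(q_π) = 0`. -/
theorem ramanujanR_qπ : ramanujanR qπ = 0 := ramanujan_values_exp_neg_two_pi_holds.2.2

/-- `ω̄₄ = R(q₀) = 0`. -/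
theorem nesterenkoOmega_qπ_four : nesterenkoOmega qπ 4 = 0 := by
  show ramanujanR qπ = 0
  exact ramanujanR_qπ

/-- The affine point `θ₃ := (q₀, P(q₀), Q(q₀))`. -/
def θ3 : Fin 3 → ℂ := ![qπ, ramanujanP qπ, ramanujanQ qπ]

/-- Its shadow `θ₂ := (q₀, P(q₀))`. -/
def θ2 : Fin 2 → ℂ := ![qπ, ramanujanP qπ]

/-- Coordinates of `θ₃ = (q_π, P(q_π), Q(q_π))`. -/
theorem θ3_eq : θ3 = fun i : Fin 3 => nesterenkoOmega qπ (Fin.castSucc i).succ := by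
  funext i; fin_cases i <;> rfl

/-- Coordinates of `θ₂ = (q_π, P(q_π))`. -/
theorem θ2_eq : θ2 = fun i : Fin 2 => θ3 (Fin.castSucc i) := by
  funext i; fin_cases i <;> rfl

/-! ## §2  The prime ideal `𝔭 = (x₄)` of `ℚ[x₀,…,x₄]` -/

/-- `𝔭 := (x₄)`. -/
def P4 : Ideal (Rx 4) := Ideal.span {(X 4 : Rx 4)}

/-- `x₄ ≠ 0` in `ℚ[x₀,…,x₄]`. -/
theorem X4_ne_zero : (X 4 : Rx 4) ≠ 0 := MvPolynomial.X_ne_zero _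

/-- `(x₄)` is a prime ideal. -/
theorem P4_isPrime : (P4).IsPrime :=
  (Ideal.span_singleton_prime X4_ne_zero).mpr MvPolynomial.X_prime

/-- `(x₄)` is homogeneous. -/
theorem P4_isHomogeneous : (P4).IsHomogeneous (MvPolynomial.homogeneousSubmodule (Fin 5) ℚ) :=
  Ideal.homogeneous_span _ _ fun x hx => by
    rw [Set.mem_singleton_iff] at hx
    subst hx
    exact ⟨1, (MvPolynomial.mem_homogeneousSubmodule 1 _).mpr (MvPolynomial.isHomogeneous_X ℚ 4)⟩

/-- `(x₄)` is unmixed of rank `4`. -/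
theorem P4_unmixed : IsUnmixedOfRank P4 4 :=
  PhilipponMain.isUnmixedOfRank_span_singleton X4_ne_zero MvPolynomial.X_prime.not_unit

/-- Prop. 4.8 at the principal ideal `(x₄)`: `deg = 1`, `h ≤ h(x₄) + 16`, `|𝔭(ω̄)| ≤ ‖x₄‖_ω̄ · e³²`. -/
theorem P4_prop48 :
    ideg P4 4 = 1 ∧ iheight P4 4 ≤ height (X 4 : Rx 4) + (4 : ℝ) ^ 2 * (1 : ℕ) ∧
      iabs P4 4 (nesterenkoOmega qπ) ≤
        normAt (nesterenkoOmega qπ) (X 4 : Rx 4) * Real.exp (2 * (4 : ℝ) ^ 2 * (1 : ℕ)) :=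
  NesterenkoPhilippon2001_ch3_prop_4_8_holds 4 (X 4) 1 (by norm_num) X4_ne_zero
    (MvPolynomial.isHomogeneous_X ℚ 4) P4_unmixed (nesterenkoOmega qπ) (nesterenkoOmega_ne_zero _)

/-- `‖x₄‖_ω̄ = |R(q_π)|`. -/
theorem normAt_X4 : normAt (nesterenkoOmega qπ) (X 4 : Rx 4) = 0 := by
  rw [normAt, MvPolynomial.aeval_X, nesterenkoOmega_qπ_four, norm_zero, zero_div]

/-- `|𝔭(ω̄)| = 0`: the point `ω̄(q₀)` lies on `V(x₄)` because `R(e^{-2π}) = 0`. -/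
theorem iabs_P4 : iabs P4 4 (nesterenkoOmega qπ) = 0 :=
  le_antisymm (by have h := P4_prop48.2.2; rwa [normAt_X4, zero_mul] at h) (iabs_nonneg _ _ _)

/-- The ideal height of `(x₄)` is non-negative. -/
theorem iheight_P4_nonneg : 0 ≤ iheight P4 4 := height_nonneg _

/-! ## §3  Homogenisation of `B ∈ ℤ[y₁,y₂,y₃]` and `E ∉ (x₄)` -/

/-- `B(y₁,y₂,y₃)` regarded in `ℤ[y₁,…,y₄]`. -/
def lift4 (B : MvPolynomial (Fin 3) ℤ) : MvPolynomial (Fin 4) ℤ := rename Fin.castSucc B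

/-- `lift4 B ≠ 0` for `B ≠ 0`. -/
theorem lift4_ne_zero {B : MvPolynomial (Fin 3) ℤ} (hB : B ≠ 0) : lift4 B ≠ 0 := fun h =>
  hB (MvPolynomial.rename_injective _ (Fin.castSucc_injective 3) (by rw [map_zero]; exact h))

/-- `totalDegree (lift4 B) ≤ totalDegree B`. -/
theorem totalDegree_lift4_le (B : MvPolynomial (Fin 3) ℤ) : (lift4 B).totalDegree ≤ B.totalDegree :=
  MvPolynomial.totalDegree_rename_le _ _

/-- `mvPolyHeight (lift4 B) ≤ mvPolyHeight B`. -/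
theorem mvPolyHeight_lift4_le (B : MvPolynomial (Fin 3) ℤ) : mvPolyHeight (lift4 B) ≤ mvPolyHeight B := by
  classical
  refine Finset.sup_le fun m hm => ?_
  rw [lift4, MvPolynomial.support_rename_of_injective (Fin.castSucc_injective 3), Finset.mem_image] at hm
  obtain ⟨u, -, rfl⟩ := hm
  rw [lift4, MvPolynomial.coeff_rename_mapDomain _ (Fin.castSucc_injective 3)]
  exact natAbs_coeff_le_mvPolyHeight B u

/-- Evaluation of `lift4 B` at `ω̄` is evaluation of `B` at `θ₃`. -/
theorem aeval_lift4 (ω : Fin 5 → ℂ) (B : MvPolynomial (Fin 3) ℤ) :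
    aeval (fun i : Fin 4 => ω i.succ) (lift4 B) = aeval (fun i : Fin 3 => ω (Fin.castSucc i).succ) B := by
  rw [lift4, MvPolynomial.aeval_rename]; rfl

/-- The homogenisation of a non-zero `B ∈ ℤ[y₁,y₂,y₃]` is not divisible by `x₄` (evaluate on the chart
`x₀ = 1, x₄ = 0`, where it restricts to `B`, and use `MvPolynomial.funext` over `ℂ`). -/
theorem homog_not_mem_P4 {B : MvPolynomial (Fin 3) ℤ} (hB : B ≠ 0) {E : Rx 4}
    (hE : ∀ ω : Fin 5 → ℂ, ω 0 = 1 → aeval ω E = aeval (fun i : Fin 4 => ω i.succ) (lift4 B)) :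
    E ∉ P4 := by
  intro hmem
  obtain ⟨D, hD⟩ := Ideal.mem_span_singleton'.mp hmem
  apply hB
  apply MvPolynomial.map_injective (Int.castRingHom ℂ) Int.cast_injective
  rw [map_zero]
  apply MvPolynomial.funext
  intro x
  rw [MvPolynomial.eval_map, ← algebraMap_int_eq, ← MvPolynomial.aeval_def, map_zero]
  set ω : Fin 5 → ℂ := ![1, x 0, x 1, x 2, 0] with hω
  have hω0 : ω 0 = 1 := rfl
  have hω4 : ω 4 = 0 := rfl
  have hx : x = fun i : Fin 3 => ω (Fin.castSucc i).succ := by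
    funext i; fin_cases i <;> rfl
  calc aeval x B = aeval (fun i : Fin 4 => ω i.succ) (lift4 B) := by rw [aeval_lift4, ← hx]
    _ = aeval ω E := (hE ω hω0).symm
    _ = 0 := by rw [← hD, map_mul, MvPolynomial.aeval_X, hω4, mul_zero]

/-! ## §4  The measure (31) at `ω̄(e^{-2π})`, from Theorem 5.1 + Prop. 4.11 -/

/-- `x ^ (4:ℝ) = x ^ 4`. -/
private theorem rpow_four (T : ℝ) : T ^ ((4 : ℝ) / (4 - ((3 : ℕ) : ℝ))) = T ^ (4 : ℕ) := by
  rw [show ((4 : ℝ) / (4 - ((3 : ℕ) : ℝ))) = ((4 : ℕ) : ℝ) by norm_num, Real.rpow_natCast]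

/-- `x ^ (24:ℝ) = x ^ 24`. -/
private theorem rpow_twentyfour (L : ℝ) :
    L ^ ((8 : ℝ) * ((3 : ℕ) : ℝ) / (4 - ((3 : ℕ) : ℝ))) = L ^ (24 : ℕ) := by
  rw [show ((8 : ℝ) * ((3 : ℕ) : ℝ) / (4 - ((3 : ℕ) : ℝ))) = ((24 : ℕ) : ℝ) by norm_num, Real.rpow_natCast]

/-- `1 ≤ log T` for `e ≤ T`. -/
private theorem one_le_log_of_exp_le {x : ℝ} (hx : Real.exp 1 ≤ x) : 1 ≤ Real.log x := by
  rw [← Real.log_exp 1]; exact Real.log_le_log (Real.exp_pos 1) hx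

set_option maxHeartbeats 800000 in
/-- **(31) at `ω̄(e^{−2π})` — the log-height transcendence measure of `(e^{−2π}, 3/π, 3Γ(1/4)⁸/(2π)⁶)`**,
derived from Theorem 5.1 (`r = 3`), Prop. 4.11 (`𝔭 = (x₄)`, `Q =` the homogenisation of `B`) and Prop. 4.8:
`∃ c > 0, ∀ B ≠ 0, ∀ T ≥ max (deg B + log H(B)) e, exp(−c T⁴ log²⁴ T) ≤ |B(θ₃)|`.
[cite: NesterenkoPhilippon2001, Ch. 3 Cor. 5.2 proof, (31) (p. 47)] -/
theorem measure31_theta3 : ∃ c : ℝ, 0 < c ∧ ∀ B : MvPolynomial (Fin 3) ℤ, B ≠ 0 → ∀ T : ℝ,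
    max ((B.totalDegree : ℝ) + Real.log (mvPolyHeight B)) (Real.exp 1) ≤ T →
      Real.exp (-(c * T ^ 4 * Real.log T ^ 24)) ≤ ‖aeval θ3 B‖ := by
  obtain ⟨μ, hμ, h51⟩ :=
    NesterenkoPhilippon2001_ch3_thm_5_1_holds qπ norm_qπ_pos norm_qπ_lt_one 3 (by norm_num) le_rfl
  obtain ⟨hdegP, -, -⟩ := P4_prop48
  set h₀ : ℝ := iheight P4 4 with hh₀
  have hh₀nn : 0 ≤ h₀ := iheight_P4_nonneg
  set c₁ : ℝ := h₀ + 25 with hc₁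
  have hc₁pos : 0 < c₁ := by rw [hc₁]; linarith
  have hc₁one : 1 ≤ c₁ := by rw [hc₁]; linarith
  have hlogc₁ : 0 ≤ Real.log c₁ := Real.log_nonneg hc₁one
  refine ⟨μ * c₁ ^ 4 * (1 + Real.log c₁) ^ 24 + (h₀ + 177), by positivity, ?_⟩
  intro B hB T hT
  have hTe : Real.exp 1 ≤ T := le_trans (le_max_right _ _) hT
  have hT1 : 1 ≤ T := le_trans (by have := Real.add_one_le_exp (1 : ℝ); linarith) hTe
  have hT0 : 0 < T := by linarith
  have hlogT : 1 ≤ Real.log T := one_le_log_of_exp_le hTe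
  have hH1 : 1 ≤ mvPolyHeight B := PhilipponMain.one_le_mvPolyHeight hB
  have hH1r : (1 : ℝ) ≤ mvPolyHeight B := by exact_mod_cast hH1
  have hlogH : 0 ≤ Real.log (mvPolyHeight B) := Real.log_nonneg hH1r
  have hnT : (B.totalDegree : ℝ) + Real.log (mvPolyHeight B) ≤ T := le_trans (le_max_left _ _) hT
  have hn0' : (0 : ℝ) ≤ B.totalDegree := Nat.cast_nonneg _
  -- the exponent is non-negative, so the left side is ≤ 1
  have hexp_le_one : Real.exp (-((μ * c₁ ^ 4 * (1 + Real.log c₁) ^ 24 + (h₀ + 177)) * T ^ 4 *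
      Real.log T ^ 24)) ≤ 1 := by
    rw [Real.exp_le_one_iff, neg_nonpos]; positivity
  rcases Nat.eq_zero_or_pos B.totalDegree with hn0 | hn1
  · -- constant polynomial: `|B(θ₃)| = |c| ≥ 1`
    have hBC : B = C (B.coeff 0) := MvPolynomial.totalDegree_eq_zero_iff_eq_C.mp hn0
    have hc0 : B.coeff 0 ≠ 0 := fun h => hB (by rw [hBC, h, map_zero])
    rw [hBC, MvPolynomial.aeval_C, algebraMap_int_eq, eq_intCast, Complex.norm_intCast]
    refine le_trans hexp_le_one ?_
    rw [← Int.cast_abs]; exact_mod_cast Int.one_le_abs hc0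
  · -- main case `n = deg B ≥ 1`
    obtain ⟨E, hEhom, hEval, hEmax, hEht, hEnz⟩ := exists_homogenization (lift4 B) (totalDegree_lift4_le B)
    obtain ⟨hE0, hEdeg⟩ := hEnz (lift4_ne_zero hB)
    have hEnot : E ∉ P4 := homog_not_mem_P4 hB hEval
    obtain ⟨J, hJhom, hJunm, -, hJdeg, hJht, hJabs⟩ :=
      (NesterenkoPhilippon2001_ch3_prop_4_11_holds 4 4 P4 E B.totalDegree (by norm_num) le_rfl
        P4_isPrime P4_isHomogeneous P4_unmixed hEhom hn1 hEnot).1 (by norm_num)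
    rw [hdegP] at hJdeg hJht hJabs
    -- heights of `E`
    have hHL1 : (1 : ℝ) ≤ mvPolyHeight (lift4 B) := by
      exact_mod_cast PhilipponMain.one_le_mvPolyHeight (lift4_ne_zero hB)
    have hHL : (mvPolyHeight (lift4 B) : ℝ) ≤ mvPolyHeight B := by exact_mod_cast mvPolyHeight_lift4_le B
    have hmaxE : 1 ≤ maxNorm E := by rw [hEmax]; exact hHL1
    have hhtE : height E ≤ Real.log (mvPolyHeight B) :=
      le_trans hEht (Real.log_le_log (by linarith) hHL)
    have hhtE0 : 0 ≤ height E := height_nonneg _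
    have hhtT : height E ≤ T := by linarith
    have hnT' : (B.totalDegree : ℝ) ≤ T := by linarith
    -- the value: `B(θ₃) = E(ω̄)`
    have hvalE : aeval (nesterenkoOmega qπ) E = aeval θ3 B := by
      rw [hEval _ (nesterenkoOmega_zero _), aeval_lift4, θ3_eq]
    -- Theorem 5.1 at `J`, `T₀ := max (h(J) + deg J) e`
    set T₀ : ℝ := max (iheight J 3 + ideg J 3) (Real.exp 1) with hT₀
    have hJunm3 : IsUnmixedOfRank J 3 := hJunm
    have h51J := h51 J hJhom hJunm3 T₀ le_rfl
    rw [rpow_four, rpow_twentyfour] at h51J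
    have hT₀e : Real.exp 1 ≤ T₀ := le_max_right _ _
    have hT₀pos : 0 < T₀ := lt_of_lt_of_le (Real.exp_pos 1) hT₀e
    have hlogT₀ : 1 ≤ Real.log T₀ := one_le_log_of_exp_le hT₀e
    -- `T₀ ≤ c₁ T`
    have hJdeg' : (ideg J 3 : ℝ) ≤ B.totalDegree := by exact_mod_cast (by simpa using hJdeg)
    have hJht' : iheight J 3 ≤ h₀ * B.totalDegree + height E + 20 * B.totalDegree := by
      have h' : iheight J 3 ≤ iheight P4 4 * (B.totalDegree : ℝ) + height E * ((1 : ℕ) : ℝ) +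
          ((4 : ℕ) : ℝ) * (((4 : ℕ) : ℝ) + 1) * ((1 : ℕ) : ℝ) * (B.totalDegree : ℝ) := hJht
      rw [← hh₀] at h'
      simp only [Nat.cast_one, mul_one, Nat.cast_ofNat] at h'
      linarith
    have h1n : h₀ * (B.totalDegree : ℝ) ≤ h₀ * T := mul_le_mul_of_nonneg_left hnT' hh₀nn
    have hh₀T : 0 ≤ h₀ * T := mul_nonneg hh₀nn hT0.le
    have hT₀le : T₀ ≤ c₁ * T := by
      refine max_le ?_ ?_
      · rw [hc₁]; linarith only [hJht', hJdeg', h1n, hhtT, hnT', hT0]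
      · rw [hc₁]; linarith only [hTe, hh₀T, hT0]
    -- `δ ≤ ‖E‖_ω̄`
    have hδ : bezoutDelta P4 4 E (nesterenkoOmega qπ) ≤ normAt (nesterenkoOmega qπ) E := by
      have := bezoutDelta_le_max P4 4 E (nesterenkoOmega qπ)
      rwa [iabs_P4, max_eq_left (normAt_nonneg _ _)] at this
    have hJabs' := hJabs (nesterenkoOmega qπ) (nesterenkoOmega_ne_zero _)
    -- chain: exp(−μ T₀⁴ log²⁴ T₀) ≤ |J(ω̄)| ≤ ‖E‖_ω̄ · exp Ξ,  Ξ ≤ (h₀ + 177) T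
    have hchain : Real.exp (-(μ * T₀ ^ 4 * Real.log T₀ ^ 24)) ≤
        normAt (nesterenkoOmega qπ) E * Real.exp ((h₀ + 177) * T) := by
      refine le_trans h51J (le_trans hJabs' (mul_le_mul hδ (Real.exp_le_exp.mpr ?_)
        (Real.exp_pos _).le (normAt_nonneg _ _)))
      rw [← hh₀]
      simp only [Nat.cast_one, mul_one, Nat.cast_ofNat]
      norm_num
      linarith only [h1n, hhtT, hnT', hT0]
    -- the main exponent comparison
    set κ : ℝ := (1 + Real.log c₁) ^ 24 with hκ
    have hκ1 : 1 ≤ κ := one_le_pow₀ (by linarith)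
    have hlogcT : Real.log (c₁ * T) ≤ (1 + Real.log c₁) * Real.log T := by
      rw [Real.log_mul hc₁pos.ne' hT0.ne']
      have h := mul_le_mul_of_nonneg_left hlogT hlogc₁
      linarith only [h]
    have hlogT₀le : Real.log T₀ ≤ (1 + Real.log c₁) * Real.log T :=
      le_trans (Real.log_le_log hT₀pos hT₀le) hlogcT
    have hpow4 : T₀ ^ 4 ≤ c₁ ^ 4 * T ^ 4 := by
      rw [← mul_pow]; exact pow_le_pow_left₀ hT₀pos.le hT₀le 4
    have hpow24 : Real.log T₀ ^ 24 ≤ κ * Real.log T ^ 24 := by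
      rw [hκ, ← mul_pow]; exact pow_le_pow_left₀ (by linarith) hlogT₀le 24
    have hA : μ * T₀ ^ 4 ≤ μ * (c₁ ^ 4 * T ^ 4) := mul_le_mul_of_nonneg_left hpow4 hμ.le
    have hmain' : μ * T₀ ^ 4 * Real.log T₀ ^ 24 ≤ μ * (c₁ ^ 4 * T ^ 4) * (κ * Real.log T ^ 24) :=
      mul_le_mul hA hpow24 (pow_nonneg (by linarith) _) (by positivity)
    have hmain : μ * T₀ ^ 4 * Real.log T₀ ^ 24 ≤ μ * c₁ ^ 4 * κ * T ^ 4 * Real.log T ^ 24 := by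
      calc μ * T₀ ^ 4 * Real.log T₀ ^ 24 ≤ μ * (c₁ ^ 4 * T ^ 4) * (κ * Real.log T ^ 24) := hmain'
        _ = μ * c₁ ^ 4 * κ * T ^ 4 * Real.log T ^ 24 := by ring
    have hlin : (h₀ + 177) * T ≤ (h₀ + 177) * T ^ 4 * Real.log T ^ 24 := by
      have h1 : T ≤ T ^ 4 := by
        calc T = T ^ 1 := (pow_one T).symm
          _ ≤ T ^ 4 := pow_le_pow_right₀ hT1 (by norm_num)
      have h2 : T ^ 4 ≤ T ^ 4 * Real.log T ^ 24 :=
        le_mul_of_one_le_right (by positivity) (one_le_pow₀ hlogT)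
      have h3 : 0 ≤ h₀ + 177 := by linarith
      calc (h₀ + 177) * T ≤ (h₀ + 177) * (T ^ 4 * Real.log T ^ 24) :=
            mul_le_mul_of_nonneg_left (le_trans h1 h2) h3
        _ = (h₀ + 177) * T ^ 4 * Real.log T ^ 24 := by ring
    have hsum : μ * T₀ ^ 4 * Real.log T₀ ^ 24 + (h₀ + 177) * T ≤
        (μ * c₁ ^ 4 * κ + (h₀ + 177)) * T ^ 4 * Real.log T ^ 24 := by
      have : (μ * c₁ ^ 4 * κ + (h₀ + 177)) * T ^ 4 * Real.log T ^ 24 =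
          μ * c₁ ^ 4 * κ * T ^ 4 * Real.log T ^ 24 + (h₀ + 177) * T ^ 4 * Real.log T ^ 24 := by ring
      rw [this]; exact add_le_add hmain hlin
    -- conclude
    have hfin : Real.exp (-((μ * c₁ ^ 4 * κ + (h₀ + 177)) * T ^ 4 * Real.log T ^ 24)) ≤
        normAt (nesterenkoOmega qπ) E := by
      have hpos : 0 < Real.exp ((h₀ + 177) * T) := Real.exp_pos _
      have h1 : Real.exp (-(μ * T₀ ^ 4 * Real.log T₀ ^ 24)) / Real.exp ((h₀ + 177) * T) ≤
          normAt (nesterenkoOmega qπ) E := (div_le_iff₀ hpos).mpr hchain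
      refine le_trans ?_ h1
      rw [← Real.exp_sub, Real.exp_le_exp]
      linarith only [hsum]
    calc Real.exp (-((μ * c₁ ^ 4 * κ + (h₀ + 177)) * T ^ 4 * Real.log T ^ 24))
        ≤ normAt (nesterenkoOmega qπ) E := hfin
      _ ≤ ‖aeval (nesterenkoOmega qπ) E‖ := normAt_le_norm_aeval _ _ hmaxE (one_le_norm_nesterenkoOmega _)
      _ = ‖aeval θ3 B‖ := by rw [hvalE]

end Summit.Schanuel.Schanuel.Theorems.RootDecomp1KPiScale

end
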